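import Mathlib
import HarnessLib
import Literature.NumberTheory.Transcendental.KZCalculus

/-!
# Candidate directions of the planar dissection: linear algebra and the pigeonhole

(Line `janus-bands`, crux `ArrangementNormalForm`, stub `stub_separateTwoZero` — separation in a
good rational direction for PLANAR arrangement representations without fibres; part `Candidates`.)

Rational forms and points of the base plane (`evq`), the candidate base changes
`A = [[σ, −1], [1, 0]]` making the direction `(1, σ)` the new `y`-axis (`Amat`, `Ainv`, `bc`,
`Apt`), crossing points (`crossq`), the pencil and separator forms of the dissection (`pencil`,
`sepf`), the sign patterns `sgn r` of the candidates `σᵣ = r + 1/2` on the pencil slopes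
`0, 1, …`, and the PIGEONHOLE (`exists_good_candidate`, registered as
`separateTwoZero_candidates`): every crossing point forbids at most one candidate (`bad_unique`),
every letter direction at most one.
-/

noncomputable section

open Set MeasureTheory Filter Topology
open scoped ENNReal

namespace Summit.KontsevichZagierPeriods.ArrangementNormalForm.JanusBands

open Literature.NumberTheory.Transcendental

namespace SepTwoZero

/-! ### Rational forms, points and the candidate base changes of the planar dissection -/

/-- Evaluation of a full-base rational form at a rational point. -/
def evq (c : (Fin (1 + 1) → ℚ) × ℚ) (X : ℚ × ℚ) : ℚ := c.1 0 * X.1 + c.1 1 * X.2 + c.2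

/-- Evaluation is linear in the form. -/
theorem evq_smul (ε : ℚ) (c : (Fin (1 + 1) → ℚ) × ℚ) (X : ℚ × ℚ) :
    evq (ε • c) X = ε * evq c X := by
  simp [evq]; ring

/-- The inverse base-change matrix for the candidate direction `(1, σ)` (new `y`-axis). -/
def Ainv (σ : ℚ) : Matrix (Fin (1 + 1)) (Fin (1 + 1)) ℚ := !![0, 1; -1, σ]

/-- The base-change matrix. -/
def Amat (σ : ℚ) : Matrix (Fin (1 + 1)) (Fin (1 + 1)) ℚ := !![σ, -1; 1, 0]

/-- `A · A⁻¹ = 1`. -/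
theorem Amat_mul_Ainv (σ : ℚ) : Amat σ * Ainv σ = 1 := by
  ext i j; fin_cases i <;> fin_cases j <;> simp [Amat, Ainv, Matrix.mul_apply, Fin.sum_univ_two]

/-- `A⁻¹ · A = 1`. -/
theorem Ainv_mul_Amat (σ : ℚ) : Ainv σ * Amat σ = 1 := by
  ext i j; fin_cases i <;> fin_cases j <;> simp [Amat, Ainv, Matrix.mul_apply, Fin.sum_univ_two]

/-- A rational point in the new coordinates. -/
def Apt (σ : ℚ) (X : ℚ × ℚ) : ℚ × ℚ := (σ * X.1 - X.2, X.1)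

/-- A rational point of the new coordinates in the old ones. -/
def Ainvpt (σ : ℚ) (Y : ℚ × ℚ) : ℚ × ℚ := (Y.2, -Y.1 + σ * Y.2)

/-- `A (A⁻¹ Y) = Y` on rational points. -/
theorem Apt_Ainvpt (σ : ℚ) (Y : ℚ × ℚ) : Apt σ (Ainvpt σ Y) = Y := by
  simp only [Apt, Ainvpt]; ext <;> ring

/-- The base change is injective on rational points. -/
theorem Apt_injective (σ : ℚ) : Function.Injective (Apt σ) := by
  intro X X' h
  simp only [Apt, Prod.mk.injEq] at h
  obtain ⟨h1, h2⟩ := h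
  rw [h2] at h1
  ext
  · exact h2
  · linarith

/-- A full-base form in the new coordinates (literal `separatePos_baseChange` dictionary). -/
def bc (σ : ℚ) (c : (Fin (1 + 1) → ℚ) × ℚ) : (Fin (1 + 1) → ℚ) × ℚ :=
  (Matrix.vecMul c.1 (Ainv σ), c.2)

/-- New `x`-coefficient of a transformed form. -/
theorem bc_fst_zero (σ : ℚ) (c : (Fin (1 + 1) → ℚ) × ℚ) : (bc σ c).1 0 = -c.1 1 := by
  simp [bc, Ainv, Matrix.vecHead, Matrix.vecTail]

/-- New `y`-coefficient of a transformed form: the derivative along the candidate direction. -/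
theorem bc_fst_one (σ : ℚ) (c : (Fin (1 + 1) → ℚ) × ℚ) : (bc σ c).1 1 = c.1 0 + c.1 1 * σ := by
  simp [bc, Ainv, Matrix.vecHead, Matrix.vecTail]

/-- The constant term is unchanged by the base change. -/
theorem bc_snd (σ : ℚ) (c : (Fin (1 + 1) → ℚ) × ℚ) : (bc σ c).2 = c.2 := rfl

/-- The base change of forms is linear. -/
theorem bc_smul (σ ε : ℚ) (c : (Fin (1 + 1) → ℚ) × ℚ) : bc σ (ε • c) = ε • bc σ c := by
  simp only [bc, Prod.smul_fst, Prod.smul_snd, Matrix.smul_vecMul, Prod.smul_mk]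

/-- Transformed forms at transformed points have the old values. -/
theorem evq_bc (σ : ℚ) (c : (Fin (1 + 1) → ℚ) × ℚ) (X : ℚ × ℚ) :
    evq (bc σ c) (Apt σ X) = evq c X := by
  rw [evq, bc_fst_zero, bc_fst_one, bc_snd, evq, Apt]; ring

/-- The base change has determinant one on pairs of forms. -/
theorem det_bc (σ : ℚ) (c c' : (Fin (1 + 1) → ℚ) × ℚ) :
    (bc σ c).1 0 * (bc σ c').1 1 - (bc σ c).1 1 * (bc σ c').1 0 =
      c.1 0 * c'.1 1 - c.1 1 * c'.1 0 := by
  rw [bc_fst_zero, bc_fst_one, bc_fst_zero, bc_fst_one]; ring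

/-- The crossing point of two non-parallel lines (Cramer). -/
def crossq (c c' : (Fin (1 + 1) → ℚ) × ℚ) : ℚ × ℚ :=
  ((c.1 1 * c'.2 - c'.1 1 * c.2) / (c.1 0 * c'.1 1 - c.1 1 * c'.1 0),
    (c'.1 0 * c.2 - c.1 0 * c'.2) / (c.1 0 * c'.1 1 - c.1 1 * c'.1 0))

/-- Uniqueness of the crossing point (Cramer's rule). -/
theorem eq_crossq {c c' : (Fin (1 + 1) → ℚ) × ℚ} {X : ℚ × ℚ}
    (hD : c.1 0 * c'.1 1 - c.1 1 * c'.1 0 ≠ 0) (h1 : evq c X = 0) (h2 : evq c' X = 0) :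
    X = crossq c c' := by
  simp only [evq] at h1 h2
  simp only [crossq]
  ext
  · rw [eq_div_iff hD]; linear_combination c'.1 1 * h1 - c.1 1 * h2
  · rw [eq_div_iff hD]; linear_combination -(c'.1 0) * h1 + c.1 0 * h2

/-- The pencil line at `X` with slope `d`: `(y − X₂) − d (x − X₁)`. -/
def pencil (X : ℚ × ℚ) (d : ℕ) : (Fin (1 + 1) → ℚ) × ℚ := (![-(d : ℚ), 1], (d : ℚ) * X.1 - X.2)

/-- Pencil forms are non-zero. -/
theorem pencil_ne_zero (X : ℚ × ℚ) (d : ℕ) : pencil X d ≠ 0 := by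
  intro h
  have := congr_arg (fun c : (Fin (1 + 1) → ℚ) × ℚ => c.1 1) h
  simp [pencil] at this

/-- A pencil line passes through its centre. -/
theorem evq_pencil (X : ℚ × ℚ) (d : ℕ) : evq (pencil X d) X = 0 := by
  simp [evq, pencil]

/-- The new `y`-coefficient of a pencil form is `σ − d`. -/
theorem bc_pencil_fst_one (σ : ℚ) (X : ℚ × ℚ) (d : ℕ) : (bc σ (pencil X d)).1 1 = σ - d := by
  rw [bc_fst_one]; simp [pencil]; ring

/-- The separator of two special points. -/
def sepf (X X' : ℚ × ℚ) : (Fin (1 + 1) → ℚ) × ℚ :=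
  if X = X' then (![0, 0], 1) else
    (![X'.1 - X.1, X'.2 - X.2], -((X'.1 - X.1) * (X.1 + X'.1) + (X'.2 - X.2) * (X.2 + X'.2)) / 2)

/-- Separator forms are non-zero. -/
theorem sepf_ne_zero (X X' : ℚ × ℚ) : sepf X X' ≠ 0 := by
  intro h
  unfold sepf at h
  split_ifs at h with hX
  · have := congr_arg Prod.snd h; simp at this
  · have h1 := congr_arg (fun c : (Fin (1 + 1) → ℚ) × ℚ => c.1 0) h
    have h2 := congr_arg (fun c : (Fin (1 + 1) → ℚ) × ℚ => c.1 1) h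
    simp at h1 h2
    exact hX (Prod.ext (by linarith) (by linarith))

/-- A separator separates its two points strictly. -/
theorem evq_sepf_mul_neg {X X' : ℚ × ℚ} (h : X ≠ X') :
    evq (sepf X X') X * evq (sepf X X') X' < 0 := by
  unfold sepf; rw [if_neg h]
  simp only [evq, Matrix.cons_val_zero, Matrix.cons_val_one]
  have hpos : 0 < (X'.1 - X.1) ^ 2 + (X'.2 - X.2) ^ 2 := by
    rcases ne_or_eq X'.1 X.1 with h1 | h1
    · have := sq_pos_of_ne_zero (sub_ne_zero.2 h1); positivity
    · have h2 : X'.2 ≠ X.2 := fun h2 => h (Prod.ext h1.symm h2.symm)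
      have := sq_pos_of_ne_zero (sub_ne_zero.2 h2); positivity
  have e1 : (X'.1 - X.1) * X.1 + (X'.2 - X.2) * X.2 +
      -((X'.1 - X.1) * (X.1 + X'.1) + (X'.2 - X.2) * (X.2 + X'.2)) / 2 =
      -(((X'.1 - X.1) ^ 2 + (X'.2 - X.2) ^ 2) / 2) := by ring
  have e2 : (X'.1 - X.1) * X'.1 + (X'.2 - X.2) * X'.2 +
      -((X'.1 - X.1) * (X.1 + X'.1) + (X'.2 - X.2) * (X.2 + X'.2)) / 2 =
      ((X'.1 - X.1) ^ 2 + (X'.2 - X.2) ^ 2) / 2 := by ring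
  rw [e1, e2]
  nlinarith

/-- The sign pattern of the candidate `r` on the pencil lines: `+` on slopes `≤ r`. -/
def sgn (r d : ℕ) : ℚ := if d ≤ r then 1 else -1

/-- The sign pattern of the candidate `r` is the sign of `σᵣ − d`. -/
theorem sgn_mul_pos (r d : ℕ) : 0 < sgn r d * ((r : ℚ) + 1 / 2 - d) := by
  unfold sgn
  split_ifs with h
  · have : (d : ℚ) ≤ r := by exact_mod_cast h
    linarith
  · have : (r : ℚ) + 1 ≤ d := by exact_mod_cast (by omega : r + 1 ≤ d)
    linarith

/-- Sign patterns take the values `±1`. -/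
theorem sgn_sq (r d : ℕ) : sgn r d = 1 ∨ sgn r d = -1 := by
  unfold sgn; split_ifs <;> simp

/-- At most one candidate is bad for a given special point (sign patterns). -/
theorem bad_unique {K : ℕ} (ε : ℕ → ℚ) {r r' : ℕ} (hr : r < K + 1) (hr' : r' < K + 1)
    (h : (∀ d < K + 2, ε d = sgn r d) ∨ (∀ d < K + 2, ε d = -sgn r d))
    (h' : (∀ d < K + 2, ε d = sgn r' d) ∨ (∀ d < K + 2, ε d = -sgn r' d)) : r = r' := by
  wlog hlt : r ≤ r' generalizing r r' with H
  · exact (H hr' hr h' h (by omega)).symm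
  rcases hlt.lt_or_eq with hlt | hlt
  · exfalso
    have h0 : sgn r 0 = 1 := by simp [sgn]
    have h0' : sgn r' 0 = 1 := by simp [sgn]
    have h1 : sgn r (r + 1) = -1 := by simp [sgn]
    have h1' : sgn r' (r + 1) = 1 := by simp [sgn]; omega
    rcases h with h | h <;> rcases h' with h' | h'
    · have := h (r + 1) (by omega); rw [h' (r + 1) (by omega), h1, h1'] at this; norm_num at this
    · have := h 0 (by omega); rw [h' 0 (by omega), h0, h0'] at this; norm_num at this
    · have := h 0 (by omega); rw [h' 0 (by omega), h0, h0'] at this; norm_num at this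
    · have := h (r + 1) (by omega); rw [h' (r + 1) (by omega), h1, h1'] at this; norm_num at this
  · exact hlt

/-- **Pigeonhole selection of a good candidate direction.** -/
theorem exists_good_candidate (𝒳 : Finset (ℚ × ℚ)) (ε : ℚ × ℚ → ℕ → ℚ) {m : ℕ}
    (lin : Fin m → Fin (1 + 1) → ℚ) :
    ∃ r < 𝒳.card + m + 1,
      (∀ X ∈ 𝒳, ¬ ((∀ d < 𝒳.card + m + 2, ε X d = sgn r d) ∨
        (∀ d < 𝒳.card + m + 2, ε X d = -sgn r d))) ∧
      (∀ i, lin i ≠ 0 → lin i 0 + lin i 1 * ((r : ℚ) + 1 / 2) ≠ 0) := by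
  classical
  set K := 𝒳.card + m with hK
  set badX : ℚ × ℚ → ℕ → Prop := fun X r => (∀ d < K + 2, ε X d = sgn r d) ∨
    (∀ d < K + 2, ε X d = -sgn r d) with hbadX
  set badL : Fin m → ℕ → Prop := fun i r => lin i ≠ 0 ∧ lin i 0 + lin i 1 * ((r : ℚ) + 1 / 2) = 0
    with hbadL
  set B := (Finset.range (K + 1)).filter fun r => (∃ X ∈ 𝒳, badX X r) ∨ ∃ i, badL i r with hB
  have hsub : B ⊆ 𝒳.biUnion (fun X => (Finset.range (K + 1)).filter fun r => badX X r) ∪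
      Finset.univ.biUnion (fun i => (Finset.range (K + 1)).filter fun r => badL i r) := by
    intro r hr
    obtain ⟨hr, h⟩ := Finset.mem_filter.1 hr
    rcases h with ⟨X, hX, h⟩ | ⟨i, h⟩
    · exact Finset.mem_union_left _ (Finset.mem_biUnion.2 ⟨X, hX, Finset.mem_filter.2 ⟨hr, h⟩⟩)
    · exact Finset.mem_union_right _ (Finset.mem_biUnion.2 ⟨i, Finset.mem_univ _,
        Finset.mem_filter.2 ⟨hr, h⟩⟩)
  have hfibX : ∀ X ∈ 𝒳, ((Finset.range (K + 1)).filter fun r => badX X r).card ≤ 1 :=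
    fun X _ => Finset.card_le_one.2 fun r hr r' hr' => by
      obtain ⟨hr1, hb⟩ := Finset.mem_filter.1 hr
      obtain ⟨hr1', hb'⟩ := Finset.mem_filter.1 hr'
      exact bad_unique (ε X) (Finset.mem_range.1 hr1) (Finset.mem_range.1 hr1') hb hb'
  have hfibL : ∀ i, ((Finset.range (K + 1)).filter fun r => badL i r).card ≤ 1 :=
    fun i => Finset.card_le_one.2 fun r hr r' hr' => by
      obtain ⟨-, hl, hb⟩ := Finset.mem_filter.1 hr
      obtain ⟨-, -, hb'⟩ := Finset.mem_filter.1 hr'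
      have h1 : lin i 1 * ((r : ℚ) - r') = 0 := by linarith
      rcases mul_eq_zero.1 h1 with h | h
      · exfalso; apply hl
        have h0 : lin i 0 = 0 := by rw [h] at hb; linarith
        funext k; fin_cases k
        · exact h0
        · exact h
      · exact_mod_cast (sub_eq_zero.1 h)
  have hcard : B.card ≤ K := by
    refine (Finset.card_le_card hsub).trans ((Finset.card_union_le _ _).trans ?_)
    have h1 : (𝒳.biUnion fun X => (Finset.range (K + 1)).filter fun r => badX X r).card ≤
        𝒳.card :=
      Finset.card_biUnion_le.trans ((Finset.sum_le_sum hfibX).trans (by simp))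
    have h2 : (Finset.univ.biUnion fun i => (Finset.range (K + 1)).filter fun r => badL i r).card
        ≤ m :=
      Finset.card_biUnion_le.trans ((Finset.sum_le_sum fun i _ => hfibL i).trans (by simp))
    omega
  have hex : ∃ r ∈ Finset.range (K + 1), r ∉ B := by
    by_contra hall
    push Not at hall
    have : (Finset.range (K + 1)).card ≤ B.card := Finset.card_le_card hall
    rw [Finset.card_range] at this
    omega
  obtain ⟨r, hr, hrB⟩ := hex
  have hgood : ¬ ((∃ X ∈ 𝒳, badX X r) ∨ ∃ i, badL i r) := fun h =>
    hrB (Finset.mem_filter.2 ⟨hr, h⟩)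
  push Not at hgood
  refine ⟨r, Finset.mem_range.1 hr, fun X hX => hgood.1 X hX, fun i hi h => ?_⟩
  exact hgood.2 i ⟨hi, h⟩

/-- Additive extension of a generator-wise congruence to the generated subgroup. -/
theorem closure_transfer' {S T : Set KZ.FormalRep}
    (h : ∀ x ∈ S, ∃ c ∈ AddSubgroup.closure T, x - c ∈ KZ.relations) :
    ∀ x ∈ AddSubgroup.closure S, ∃ c ∈ AddSubgroup.closure T, x - c ∈ KZ.relations := by
  intro x hx
  induction hx using AddSubgroup.closure_induction with
  | mem x hx => exact h x hx
  | zero => exact ⟨0, zero_mem _, by simp⟩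
  | add x y _ _ ihx ihy =>
    obtain ⟨m₁, hm₁, h₁⟩ := ihx
    obtain ⟨m₂, hm₂, h₂⟩ := ihy
    refine ⟨m₁ + m₂, add_mem hm₁ hm₂, ?_⟩
    have key := add_mem h₁ h₂
    rwa [show x - m₁ + (y - m₂) = x + y - (m₁ + m₂) by abel] at key
  | neg x _ ih =>
    obtain ⟨m, hm, h⟩ := ih
    refine ⟨-m, neg_mem hm, ?_⟩
    have key := neg_mem h
    rwa [show -(x - m) = -x - -m by abel] at key

end SepTwoZero

open SepTwoZero in
/-- **Pigeonhole choice of a good candidate direction** (registered sub-goal of `stub_separateTwoZero`). -/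
theorem separateTwoZero_candidates (𝒳 : Finset (ℚ × ℚ)) (ε : ℚ × ℚ → ℕ → ℚ) (m : ℕ) (lin : Fin m → Fin (1 + 1) → ℚ) : ∃ r < 𝒳.card + m + 1, (∀ X ∈ 𝒳, ¬ ((∀ d < 𝒳.card + m + 2, ε X d = if d ≤ r then (1 : ℚ) else -1) ∨ (∀ d < 𝒳.card + m + 2, ε X d = -(if d ≤ r then (1 : ℚ) else -1)))) ∧ (∀ i, lin i ≠ 0 → lin i 0 + lin i 1 * ((r : ℚ) + 1 / 2) ≠ 0) := by
  exact exists_good_candidate 𝒳 ε lin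

end Summit.KontsevichZagierPeriods.ArrangementNormalForm.JanusBands
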